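import Literature.NumberTheory.Transcendental.MultipleZetaProofs
import HarnessLib

/-!
# Multiple zeta values — the harmonic (stuffle) product (Hoffman 1997, Theorems 3.2 and 4.2)

Sibling proof file of `Literature.NumberTheory.Transcendental.MultipleZeta` (D-0014: cited results
are named facts `def X : Prop` there; this file discharges one of them). It proves

* `Literature.NumberTheory.Transcendental.mem_mzvSpace_mul_holds` : `𝒵_a · 𝒵_b ⊆ 𝒵_{a+b}`, i.e.
  the product of two multiple zeta values of weights `a`, `b` is a `ℤ`-linear (indeed `ℕ`-linear)
  combination of multiple zeta values of weight `a + b` — Hoffman 1997, Theorem 4.2: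
  `ζ : (𝔥⁰, ∗) → ℝ` is a homomorphism for the harmonic product `∗`;

via the explicit product formula `multipleZeta_mul : ζ(s) ζ(t) = ∑_{u ∈ s ∗ t} ζ(u)` for
admissible `s`, `t` (e.g. `ζ(2)ζ(2,1) = 2ζ(2,2,1) + ζ(2,1,2) + ζ(4,1) + ζ(2,3)`, [Hoffman1997, §1]).
Users holding `(h : mem_mzvSpace_mul)` are fed `mem_mzvSpace_mul_holds`.

## The source and this file

We follow Hoffman's proof [Hoffman1997, §2–§4] literally, in Zagier's (decreasing) summation
convention used by `Literature.NumberTheory.Transcendental.multipleZeta`. For an index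
`s = (s₁, …, s_k)` and `N ∈ ℕ` let `Z_N(s) = ∑_{N > n₁ > ⋯ > n_k ≥ 1} ∏ᵢ nᵢ^{-sᵢ}`
(`MZV.mzvTrunc s N`; this is Hoffman's `φ_{N-1}(z_{s₁} ⋯ z_{s_k})` of §3 evaluated at `tᵢ = 1/i`).

1. `MZV.stuffle s t` is the harmonic product `s ∗ t` ("stuffle", quasi-shuffle) of two indices as
   a list of indices with multiplicity, defined by Hoffman's rules (A1)–(A3) of §2 (p. 479) in the
   letters `z_i = x^{i-1} y`: `as' ∗ bt' = a(s' ∗ bt') + b(as' ∗ t') + (a+b)(s' ∗ t')`. Every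
   `u ∈ s ∗ t` has weight `|s| + |t|` (`MZV.sum_of_mem_stuffle`) and is admissible when `s`, `t`
   are (`MZV.isAdmissible_of_mem_stuffle`; `𝔥⁰` is a `∗`-subalgebra, §4).
2. `MZV.mzvTrunc_mul` is Hoffman's **Theorem 3.2** (p. 485): for EVERY `N`,
   `Z_N(s) · Z_N(t) = ∑_{u ∈ s ∗ t} Z_N(u)`, by Hoffman's induction on `ℓ(s) + ℓ(t)`: with
   `Z_N(a s') = ∑_{1 ≤ n < N} n^{-a} Z_n(s')` (`MZV.mzvTrunc_cons`, Hoffman's (∗)), the product of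
   the two outer sums splits into the terms with `n₁ > m₁`, `m₁ > n₁`, `n₁ = m₁`
   (`MZV.sum_Ico_sum_Ico_split`), which are the three terms of (A3).
3. `multipleZeta_mul` is Hoffman's **Theorem 4.2** (p. 488), "taking limits in Theorem 3.2":
   `Z_N(u) → ζ(u)` for admissible `u` (`MZV.tendsto_mzvTrunc`, from the convergence
   `summable_of_isAdmissible_holds` of `MultipleZetaProofs.lean`: the truncations exhaust the
   summation domain), and limits of finite sums and products.
4. `mem_mzvSpace_mul_holds` extends 3. to the `ℚ`-spans by bilinearity (`Submodule.span_mul_span`).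

The summation domain `mzvIndexSet k ⊆ (Fin k → ℕ)` of `multipleZeta` is fixed by that definition;
its truncations are realised as the recursively defined finsets `MZV.truncSet k N`
(`MZV.mem_truncSet_iff`), which is what makes the recursion (∗) available.
No named facts are introduced; the only new definitions are the three combinatorial gadgets
`MZV.stuffle`, `MZV.truncSet`, `MZV.mzvTrunc` needed to phrase Hoffman's argument. Not here:
commutativity/associativity of `∗` (Theorem 2.1), the polynomial-algebra structure theorems
(2.6, 3.1, 4.1), the shuffle product and regularisation (§5–§6).

## References

* M. E. Hoffman, *The algebra of multiple harmonic series*, J. Algebra **194** (1997), 477–495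
  (doi:10.1006/jabr.1997.7127): §2 rules (A1)–(A3), p. 479; Theorem 3.2, p. 485; Theorem 4.2,
  p. 488. [Hoffman1997]
* D. Zagier, *Values of zeta functions and their applications*, First European Congress of
  Mathematics (Paris, 1992), Vol. II, Progr. Math. 120, Birkhäuser (1994), 497–512, §9.
  [Zagier1994]
-/

noncomputable section

open scoped BigOperators
open Filter Topology

namespace Literature.NumberTheory.Transcendental

namespace MZV

/-! ### The harmonic (stuffle) product of indices -/

/-- The *harmonic product* (quasi-shuffle, "stuffle") `s ∗ t` of two indices, as the list (with
multiplicity) of the indices occurring in `z_s ∗ z_t`, computed by Hoffman's rules (A1)–(A3):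
`[] ∗ t = t`, `s ∗ [] = s`, `as' ∗ bt' = a(s' ∗ bt') + b(as' ∗ t') + (a+b)(s' ∗ t')`.
[cite: Hoffman1997, §2 (A1)–(A3)] -/
def stuffle : List ℕ → List ℕ → List (List ℕ)
  | [], t => [t]
  | a :: s, [] => [a :: s]
  | a :: s, b :: t =>
      (stuffle s (b :: t)).map (List.cons a) ++
        ((stuffle (a :: s) t).map (List.cons b) ++ (stuffle s t).map (List.cons (a + b)))
termination_by s t => s.length + t.length

/-- Rule (A1): `[] ∗ t = t`. [cite: Hoffman1997, §2 (A1)] -/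
@[simp] theorem stuffle_nil_left (t : List ℕ) : stuffle [] t = [t] := by
  simp [stuffle]

/-- Rule (A1): `s ∗ [] = s`. [cite: Hoffman1997, §2 (A1)] -/
@[simp] theorem stuffle_nil_right (s : List ℕ) : stuffle s [] = [s] := by
  cases s <;> simp [stuffle]

/-- Rule (A3): `as ∗ bt = a(s ∗ bt) + b(as ∗ t) + (a+b)(s ∗ t)`. [cite: Hoffman1997, §2 (A3)] -/
theorem stuffle_cons_cons (a b : ℕ) (s t : List ℕ) :
    stuffle (a :: s) (b :: t) =
      (stuffle s (b :: t)).map (List.cons a) ++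
        ((stuffle (a :: s) t).map (List.cons b) ++ (stuffle s t).map (List.cons (a + b))) := by
  simp [stuffle]

/-- The harmonic product is homogeneous for the weight: every index in `s ∗ t` has weight
`|s| + |t|` (Hoffman 1997, §3: `φₙ` preserves the grading). [cite: Hoffman1997, §3] -/
theorem sum_of_mem_stuffle : ∀ (s t : List ℕ) {u : List ℕ}, u ∈ stuffle s t →
    u.sum = s.sum + t.sum := by
  intro s t
  induction s, t using stuffle.induct with
  | case1 t => intro u hu; simp only [stuffle_nil_left, List.mem_singleton] at hu; simp [hu]
  | case2 a s => intro u hu; simp only [stuffle_nil_right, List.mem_singleton] at hu; simp [hu]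
  | case3 a s b t ih1 ih2 ih3 =>
    intro u hu
    simp only [stuffle_cons_cons, List.mem_append, List.mem_map] at hu
    rcases hu with ⟨v, hv, rfl⟩ | ⟨v, hv, rfl⟩ | ⟨v, hv, rfl⟩
    · simp only [List.sum_cons, ih1 hv]; omega
    · simp only [List.sum_cons, ih2 hv]; omega
    · simp only [List.sum_cons, ih3 hv]; omega

/-- If all entries of `s` and `t` are positive, so are all entries of every index in `s ∗ t`.
[folklore] -/
theorem one_le_of_mem_stuffle : ∀ (s t : List ℕ), (∀ i ∈ s, 1 ≤ i) → (∀ i ∈ t, 1 ≤ i) →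
    ∀ u ∈ stuffle s t, ∀ i ∈ u, 1 ≤ i := by
  intro s t
  induction s, t using stuffle.induct with
  | case1 t =>
    intro _ ht u hu
    simp only [stuffle_nil_left, List.mem_singleton] at hu
    subst hu; exact ht
  | case2 a s =>
    intro hs _ u hu
    simp only [stuffle_nil_right, List.mem_singleton] at hu
    subst hu; exact hs
  | case3 a s b t ih1 ih2 ih3 =>
    intro hs ht u hu
    have ha : 1 ≤ a := hs a (by simp)
    have hb : 1 ≤ b := ht b (by simp)
    have hs' : ∀ i ∈ s, 1 ≤ i := fun i hi => hs i (by simp [hi])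
    have ht' : ∀ i ∈ t, 1 ≤ i := fun i hi => ht i (by simp [hi])
    simp only [stuffle_cons_cons, List.mem_append, List.mem_map] at hu
    rcases hu with ⟨v, hv, rfl⟩ | ⟨v, hv, rfl⟩ | ⟨v, hv, rfl⟩
    · intro i hi
      rcases List.mem_cons.mp hi with rfl | hi
      · exact ha
      · exact ih1 hs' ht v hv i hi
    · intro i hi
      rcases List.mem_cons.mp hi with rfl | hi
      · exact hb
      · exact ih2 hs ht' v hv i hi
    · intro i hi
      rcases List.mem_cons.mp hi with rfl | hi
      · omega
      · exact ih3 hs' ht' v hv i hi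

/-- The first entry of an index in `s ∗ t` is `s₁`, `t₁` or `s₁ + t₁`; in particular it is `≥ 2`
when `s` and `t` are admissible. [folklore] -/
theorem two_le_head_of_mem_stuffle {s t u : List ℕ} (hs : IsAdmissible s) (ht : IsAdmissible t)
    (hu : u ∈ stuffle s t) (h : u ≠ []) : 2 ≤ u.head h := by
  rcases s with _ | ⟨a, s⟩
  · simp only [stuffle_nil_left, List.mem_singleton] at hu
    subst hu; exact ht.2 h
  rcases t with _ | ⟨b, t⟩
  · simp only [stuffle_nil_right, List.mem_singleton] at hu
    subst hu; exact hs.2 h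
  have ha : 2 ≤ a := by simpa using hs.2 (List.cons_ne_nil a s)
  have hb : 2 ≤ b := by simpa using ht.2 (List.cons_ne_nil b t)
  simp only [stuffle_cons_cons, List.mem_append, List.mem_map] at hu
  rcases hu with ⟨v, -, rfl⟩ | ⟨v, -, rfl⟩ | ⟨v, -, rfl⟩
  · simpa using ha
  · simpa using hb
  · simp only [List.head_cons]; omega

/-- The harmonic product of two admissible indices consists of admissible indices
(so `𝔥⁰` is a subalgebra for `∗`, Hoffman 1997, §4). [cite: Hoffman1997, §4] -/
theorem isAdmissible_of_mem_stuffle {s t u : List ℕ} (hs : IsAdmissible s) (ht : IsAdmissible t)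
    (hu : u ∈ stuffle s t) : IsAdmissible u :=
  ⟨one_le_of_mem_stuffle s t hs.1 ht.1 u hu, two_le_head_of_mem_stuffle hs ht hu⟩

/-! ### Truncated nested sums -/

/-- `(m, n') ↦ (m, n'₁, …, n'_k)` is injective. [folklore] -/
theorem consSigma_injective (k : ℕ) :
    Function.Injective
      (fun p : (Σ _ : ℕ, (Fin k → ℕ)) => (Fin.cons p.1 p.2 : Fin (k + 1) → ℕ)) := by
  rintro ⟨m, n⟩ ⟨m', n'⟩ h
  obtain ⟨rfl, rfl⟩ := Fin.cons_inj.mp h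
  rfl

/-- The finite summation domain `{(n₁, …, n_k) : N > n₁ > ⋯ > n_k ≥ 1}` of the truncated multiple
zeta sum, built recursively on `k` by choosing `n₁ ∈ [1, N)` and then `(n₂, …, n_k)` below `n₁`
(the index set of Hoffman's `φ_{N-1}`). [cite: Hoffman1997, §3] -/
def truncSet : (k : ℕ) → ℕ → Finset (Fin k → ℕ)
  | 0, _ => {Fin.elim0}
  | k + 1, N => ((Finset.Ico 1 N).sigma fun m => truncSet k m).map ⟨_, consSigma_injective k⟩

/-- Unfolding the recursion: `n ∈ truncSet (k+1) N` iff `n = (m, n')` with `1 ≤ m < N` and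
`n' ∈ truncSet k m`. [folklore] -/
theorem mem_truncSet_succ_iff {k N : ℕ} {n : Fin (k + 1) → ℕ} :
    n ∈ truncSet (k + 1) N ↔
      ∃ m ∈ Finset.Ico 1 N, ∃ n' ∈ truncSet k m, (Fin.cons m n' : Fin (k + 1) → ℕ) = n := by
  rw [truncSet, Finset.mem_map]
  constructor
  · rintro ⟨⟨m, n'⟩, hp, rfl⟩
    rw [Finset.mem_sigma] at hp
    exact ⟨m, hp.1, n', hp.2, rfl⟩
  · rintro ⟨m, hm, n', hn', rfl⟩
    exact ⟨⟨m, n'⟩, Finset.mem_sigma.mpr ⟨hm, hn'⟩, rfl⟩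

/-- Summing over `truncSet (k+1) N` = summing over the first entry `m ∈ [1, N)` and then over
`truncSet k m`. [folklore] -/
theorem sum_truncSet_succ (k N : ℕ) (f : (Fin (k + 1) → ℕ) → ℝ) :
    ∑ n ∈ truncSet (k + 1) N, f n =
      ∑ m ∈ Finset.Ico 1 N, ∑ n ∈ truncSet k m, f (Fin.cons m n) := by
  rw [truncSet, Finset.sum_map, Finset.sum_sigma]
  rfl

/-- Prepending a larger entry to a strictly decreasing tuple keeps it strictly decreasing.
[folklore] -/
theorem strictAnti_fin_cons {k m : ℕ} {n : Fin k → ℕ} (hn : StrictAnti n) (hm : ∀ i, n i < m) :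
    StrictAnti (Fin.cons m n : Fin (k + 1) → ℕ) := by
  intro i j hij
  obtain rfl | ⟨j, rfl⟩ := j.eq_zero_or_eq_succ
  · exact absurd hij (by simp)
  · obtain rfl | ⟨i, rfl⟩ := i.eq_zero_or_eq_succ
    · simp only [Fin.cons_succ, Fin.cons_zero]
      exact hm j
    · simp only [Fin.cons_succ]
      exact hn (Fin.succ_lt_succ_iff.mp hij)

/-- `truncSet k N` is exactly the set of strictly decreasing `k`-tuples of positive integers all of
whose entries are `< N`, i.e. the truncation `{n ∈ mzvIndexSet k | n₁ < N}`. [folklore] -/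
theorem mem_truncSet_iff : ∀ {k N : ℕ} {n : Fin k → ℕ},
    n ∈ truncSet k N ↔ n ∈ mzvIndexSet k ∧ ∀ i, n i < N
  | 0, N, n => by
      simp only [truncSet, Finset.mem_singleton, mzvIndexSet, Set.mem_setOf_eq]
      exact ⟨fun _ => ⟨⟨fun i => i.elim0, fun i => i.elim0⟩, fun i => i.elim0⟩,
        fun _ => funext fun i => i.elim0⟩
  | k + 1, N, n => by
      rw [mem_truncSet_succ_iff]
      simp only [mzvIndexSet, Set.mem_setOf_eq]
      constructor
      · rintro ⟨m, hm, n', hn', rfl⟩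
        rw [Finset.mem_Ico] at hm
        obtain ⟨⟨hanti, hpos⟩, hlt⟩ := (mem_truncSet_iff (k := k)).mp hn'
        refine ⟨⟨strictAnti_fin_cons hanti hlt, fun i => ?_⟩, fun i => ?_⟩
        · obtain rfl | ⟨i, rfl⟩ := i.eq_zero_or_eq_succ
          · simp only [Fin.cons_zero]; exact hm.1
          · simp only [Fin.cons_succ]; exact hpos i
        · obtain rfl | ⟨i, rfl⟩ := i.eq_zero_or_eq_succ
          · simp only [Fin.cons_zero]; exact hm.2
          · simp only [Fin.cons_succ]; exact (hlt i).trans hm.2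
      · rintro ⟨⟨hanti, hpos⟩, hlt⟩
        refine ⟨n 0, ?_, Fin.tail n, ?_, Fin.cons_self_tail n⟩
        · rw [Finset.mem_Ico]; exact ⟨hpos 0, hlt 0⟩
        · exact (mem_truncSet_iff (k := k)).mpr
            ⟨⟨fun i j h => hanti (Fin.succ_lt_succ_iff.mpr h), fun i => hpos _⟩,
              fun i => hanti (Fin.succ_pos i)⟩

/-- Every finite set of indices lies in all sufficiently large truncations. [folklore] -/
theorem exists_forall_mem_truncSet {k : ℕ} (u : Finset (mzvIndexSet k)) :
    ∃ N, ∀ N', N ≤ N' → ∀ x ∈ u, (x : Fin k → ℕ) ∈ truncSet k N' := by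
  refine ⟨u.sup (fun x => Finset.univ.sup (x : Fin k → ℕ)) + 1, fun N' hN' x hx => ?_⟩
  rw [mem_truncSet_iff]
  refine ⟨x.2, fun i => ?_⟩
  have h1 : (x : Fin k → ℕ) i ≤ Finset.univ.sup (x : Fin k → ℕ) :=
    Finset.le_sup (f := (x : Fin k → ℕ)) (Finset.mem_univ i)
  have h2 : Finset.univ.sup (x : Fin k → ℕ) ≤ u.sup (fun x => Finset.univ.sup (x : Fin k → ℕ)) :=
    Finset.le_sup (f := fun x : mzvIndexSet k => Finset.univ.sup (x : Fin k → ℕ)) hx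
  omega

/-- `∏ᵢ nᵢ^{-sᵢ}` for the index `a :: s` and the tuple `(m, n)` factors as
`m^{-a} · ∏ᵢ nᵢ^{-sᵢ}`. [folklore] -/
theorem mzvTerm_cons (a : ℕ) (s : List ℕ) (m : ℕ) (n : Fin s.length → ℕ) :
    mzvTerm (a :: s) (Fin.cons m n) = ((m : ℝ) ^ a)⁻¹ * mzvTerm s n := by
  simp [mzvTerm, Fin.prod_univ_succ, mul_comm]

/-- The truncated multiple zeta value `Z_N(s) = ∑_{N > n₁ > ⋯ > n_k ≥ 1} ∏ᵢ nᵢ^{-sᵢ}`, i.e.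
Hoffman's `φ_{N-1}(z_{s₁} ⋯ z_{s_k})` evaluated at `tᵢ = 1/i`. [cite: Hoffman1997, §3] -/
def mzvTrunc (s : List ℕ) (N : ℕ) : ℝ := ∑ n ∈ truncSet s.length N, mzvTerm s n

/-- `Z_N(∅) = 1`. [folklore] -/
@[simp] theorem mzvTrunc_nil (N : ℕ) : mzvTrunc [] N = 1 := by
  simp [mzvTrunc, truncSet, mzvTerm]

/-- Hoffman's recursion `φₙ(z_p w) = ∑_{m ≤ n} t_m^p φ_{m-1}(w)`:
`Z_N(a :: s) = ∑_{1 ≤ m < N} m^{-a} Z_m(s)`. [cite: Hoffman1997, §3 (∗)] -/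
theorem mzvTrunc_cons (a : ℕ) (s : List ℕ) (N : ℕ) :
    mzvTrunc (a :: s) N = ∑ m ∈ Finset.Ico 1 N, ((m : ℝ) ^ a)⁻¹ * mzvTrunc s m := by
  have h := sum_truncSet_succ s.length N (fun n => mzvTerm (a :: s) n)
  simp only [mzvTerm_cons, ← Finset.mul_sum] at h
  exact h

/-! ### The harmonic product formula for truncated sums (Hoffman 1997, Theorem 3.2) -/

/-- Interchanging a finite sum with a sum over a list. [folklore] -/
theorem sum_list_map_comm {ι : Type*} (I : Finset ι) (L : List (List ℕ))
    (g : ι → List ℕ → ℝ) :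
    ∑ n ∈ I, (L.map (g n)).sum = (L.map fun u => ∑ n ∈ I, g n u).sum := by
  induction L with
  | nil => simp
  | cons u L ih => simp only [List.map_cons, List.sum_cons, Finset.sum_add_distrib, ih]

/-- Splitting a double sum over `[1, N)²` according to `m < n`, `m > n`, `m = n` (the three types
of terms in Hoffman's proof of Theorem 3.2). [folklore] -/
theorem sum_Ico_sum_Ico_split (N : ℕ) (F : ℕ → ℕ → ℝ) :
    ∑ n ∈ Finset.Ico 1 N, ∑ m ∈ Finset.Ico 1 N, F n m =
      ∑ n ∈ Finset.Ico 1 N, ∑ m ∈ Finset.Ico 1 n, F n m +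
        ∑ m ∈ Finset.Ico 1 N, ∑ n ∈ Finset.Ico 1 m, F n m +
        ∑ n ∈ Finset.Ico 1 N, F n n := by
  have h1 : ∀ n ∈ Finset.Ico 1 N, ∑ m ∈ Finset.Ico 1 N, F n m =
      ∑ m ∈ Finset.Ico 1 n, F n m + ∑ m ∈ Finset.Ioo n N, F n m + F n n := by
    intro n hn
    rw [Finset.mem_Ico] at hn
    rw [← Finset.sum_Ico_consecutive (F n) hn.1 hn.2.le, Finset.sum_eq_sum_Ico_succ_bot hn.2,
      Finset.Ico_add_one_left_eq_Ioo]
    ring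
  rw [Finset.sum_congr rfl h1, Finset.sum_add_distrib, Finset.sum_add_distrib]
  have h2 : ∑ n ∈ Finset.Ico 1 N, ∑ m ∈ Finset.Ioo n N, F n m =
      ∑ m ∈ Finset.Ico 1 N, ∑ n ∈ Finset.Ico 1 m, F n m := by
    apply Finset.sum_comm'
    intro n m
    simp only [Finset.mem_Ico, Finset.mem_Ioo]
    omega
  rw [h2]

/-- **Hoffman's Theorem 3.2** (harmonic product of truncated sums): for every `N`,
`Z_N(s) · Z_N(t) = ∑_{u ∈ s ∗ t} Z_N(u)`. The proof is Hoffman's: induction on `ℓ(s) + ℓ(t)`,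
splitting the product of the two outer sums into the terms with `n₁ > m₁`, `m₁ > n₁` and
`n₁ = m₁`. [cite: Hoffman1997, Theorem 3.2] -/
theorem mzvTrunc_mul : ∀ (s t : List ℕ) (N : ℕ),
    mzvTrunc s N * mzvTrunc t N = ((stuffle s t).map fun u => mzvTrunc u N).sum := by
  intro s t
  induction s, t using stuffle.induct with
  | case1 t => intro N; simp
  | case2 a s => intro N; simp
  | case3 a s b t ih1 ih2 ih3 =>
    intro N
    simp only [stuffle_cons_cons, List.map_append, List.sum_append, List.map_map,
      Function.comp_def]
    have e1 : ((stuffle s (b :: t)).map fun u => mzvTrunc (a :: u) N).sum =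
        ∑ n ∈ Finset.Ico 1 N, ((n : ℝ) ^ a)⁻¹ * (mzvTrunc s n * mzvTrunc (b :: t) n) := by
      calc ((stuffle s (b :: t)).map fun u => mzvTrunc (a :: u) N).sum
          = ((stuffle s (b :: t)).map fun u =>
              ∑ n ∈ Finset.Ico 1 N, ((n : ℝ) ^ a)⁻¹ * mzvTrunc u n).sum := by
            simp only [mzvTrunc_cons]
        _ = ∑ n ∈ Finset.Ico 1 N,
              ((stuffle s (b :: t)).map fun u => ((n : ℝ) ^ a)⁻¹ * mzvTrunc u n).sum :=
            (sum_list_map_comm _ _ _).symm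
        _ = _ := by simp only [List.sum_map_mul_left, ih1]
    have e2 : ((stuffle (a :: s) t).map fun u => mzvTrunc (b :: u) N).sum =
        ∑ m ∈ Finset.Ico 1 N, ((m : ℝ) ^ b)⁻¹ * (mzvTrunc (a :: s) m * mzvTrunc t m) := by
      calc ((stuffle (a :: s) t).map fun u => mzvTrunc (b :: u) N).sum
          = ((stuffle (a :: s) t).map fun u =>
              ∑ m ∈ Finset.Ico 1 N, ((m : ℝ) ^ b)⁻¹ * mzvTrunc u m).sum := by
            simp only [mzvTrunc_cons]
        _ = ∑ m ∈ Finset.Ico 1 N,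
              ((stuffle (a :: s) t).map fun u => ((m : ℝ) ^ b)⁻¹ * mzvTrunc u m).sum :=
            (sum_list_map_comm _ _ _).symm
        _ = _ := by simp only [List.sum_map_mul_left, ih2]
    have e3 : ((stuffle s t).map fun u => mzvTrunc ((a + b) :: u) N).sum =
        ∑ n ∈ Finset.Ico 1 N, ((n : ℝ) ^ (a + b))⁻¹ * (mzvTrunc s n * mzvTrunc t n) := by
      calc ((stuffle s t).map fun u => mzvTrunc ((a + b) :: u) N).sum
          = ((stuffle s t).map fun u =>
              ∑ n ∈ Finset.Ico 1 N, ((n : ℝ) ^ (a + b))⁻¹ * mzvTrunc u n).sum := by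
            simp only [mzvTrunc_cons]
        _ = ∑ n ∈ Finset.Ico 1 N,
              ((stuffle s t).map fun u => ((n : ℝ) ^ (a + b))⁻¹ * mzvTrunc u n).sum :=
            (sum_list_map_comm _ _ _).symm
        _ = _ := by simp only [List.sum_map_mul_left, ih3]
    rw [e1, e2, e3]
    simp only [mzvTrunc_cons]
    rw [Finset.sum_mul_sum, sum_Ico_sum_Ico_split, add_assoc]
    congr 1
    · refine Finset.sum_congr rfl fun n _ => ?_
      rw [Finset.mul_sum, Finset.mul_sum]
      refine Finset.sum_congr rfl fun m _ => ?_
      ring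
    congr 1
    · refine Finset.sum_congr rfl fun m _ => ?_
      rw [Finset.sum_mul, Finset.mul_sum]
      refine Finset.sum_congr rfl fun n _ => ?_
      ring
    · refine Finset.sum_congr rfl fun n _ => ?_
      rw [pow_add, mul_inv]
      ring

/-! ### Limits `N → ∞` (Hoffman 1997, Theorem 4.2) -/

/-- `Z_N(s) → ζ(s)` as `N → ∞` for admissible `s` (Hoffman 1997, §4:
`ζ(w) = lim_{n → ∞} φₙ(w)(1, 1/2, …, 1/n)`). [cite: Hoffman1997, §4] -/
theorem tendsto_mzvTrunc {s : List ℕ} (hs : IsAdmissible s) :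
    Tendsto (mzvTrunc s) atTop (𝓝 (multipleZeta s)) := by
  classical
  have hf : HasSum (fun n : mzvIndexSet s.length => mzvTerm s n.1) (multipleZeta s) :=
    (summable_of_isAdmissible_holds hs).hasSum
  let T : ℕ → Finset (mzvIndexSet s.length) := fun N =>
    (truncSet s.length N).subtype (· ∈ mzvIndexSet s.length)
  have hT : Tendsto T atTop atTop := by
    rw [tendsto_atTop_atTop]
    intro u
    obtain ⟨N, hN⟩ := exists_forall_mem_truncSet u
    exact ⟨N, fun N' hN' x hx => Finset.mem_subtype.mpr (hN N' hN' x hx)⟩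
  refine Filter.Tendsto.congr (fun N => ?_) (hf.comp hT)
  simp only [Function.comp_apply, T, mzvTrunc]
  exact Finset.sum_subtype_of_mem (fun n => mzvTerm s n) fun n hn => (mem_truncSet_iff.mp hn).1

end MZV

/-- **Hoffman's Theorem 4.2** (`ζ` is a homomorphism for the harmonic product): for admissible
indices `s`, `t`, `ζ(s) ζ(t) = ∑_{u ∈ s ∗ t} ζ(u)`, obtained from Theorem 3.2
(`MZV.mzvTrunc_mul`) by letting `N → ∞`. E.g. `ζ(2)ζ(2,1) = 2ζ(2,2,1) + ζ(2,1,2) + ζ(4,1) + ζ(2,3)`.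
[cite: Hoffman1997, Theorem 4.2] -/
theorem multipleZeta_mul {s t : List ℕ} (hs : MZV.IsAdmissible s) (ht : MZV.IsAdmissible t) :
    multipleZeta s * multipleZeta t = ((MZV.stuffle s t).map multipleZeta).sum := by
  have h1 : Tendsto (fun N => MZV.mzvTrunc s N * MZV.mzvTrunc t N) atTop
      (𝓝 (multipleZeta s * multipleZeta t)) :=
    (MZV.tendsto_mzvTrunc hs).mul (MZV.tendsto_mzvTrunc ht)
  have h2 : Tendsto (fun N => ((MZV.stuffle s t).map fun u => MZV.mzvTrunc u N).sum) atTop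
      (𝓝 ((MZV.stuffle s t).map multipleZeta).sum) :=
    tendsto_list_sum _ fun u hu =>
      MZV.tendsto_mzvTrunc (MZV.isAdmissible_of_mem_stuffle hs ht hu)
  simp only [MZV.mzvTrunc_mul] at h1
  exact tendsto_nhds_unique h1 h2

/-- **Discharge of `mem_mzvSpace_mul`**: `𝒵_a · 𝒵_b ⊆ 𝒵_{a+b}` — the product of two multiple
zeta values of weights `a` and `b` is a `ℤ`-linear (indeed `ℕ`-linear) combination of multiple
zeta values of weight `a + b`, by the harmonic (stuffle) product formula, Hoffman 1997,
Theorem 4.2 (`multipleZeta_mul`), extended to the `ℚ`-spans by bilinearity.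
[cite: Hoffman1997, Theorem 4.2] -/
theorem mem_mzvSpace_mul_holds : mem_mzvSpace_mul := by
  intro a b x y hx hy
  have key : mzvSpace a * mzvSpace b ≤ mzvSpace (a + b) := by
    simp only [mzvSpace]
    rw [Submodule.span_mul_span, Submodule.span_le]
    rintro _ ⟨x, ⟨s, hs, hws, rfl⟩, y, ⟨t, ht, hwt, rfl⟩, rfl⟩
    show multipleZeta s * multipleZeta t ∈ Submodule.span ℚ _
    rw [multipleZeta_mul hs ht]
    refine list_sum_mem fun z hz => ?_
    obtain ⟨u, hu, rfl⟩ := List.mem_map.mp hz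
    refine Submodule.subset_span ⟨u, MZV.isAdmissible_of_mem_stuffle hs ht hu, ?_, rfl⟩
    simp only [MZV.weight] at hws hwt ⊢
    rw [MZV.sum_of_mem_stuffle s t hu, hws, hwt]
  exact key (Submodule.mul_mem_mul hx hy)

end Literature.NumberTheory.Transcendental
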